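import Summits.Ventures.PercRepro.RankLevelSetTriangleStar
import Summits.Ventures.PercRepro.RankLevelSetPlaneTenTraces
import Summits.Ventures.PercRepro.RankLevelSetPlaneSix

/-!
# PercRepro — the triangle-cap bridge, SELF-CONTAINED (p3 g21; the (um)(36)(2) device for an olean-bound parent)

`TriangleNullity` (d1799) is landed but has no olean on the farm (OPS-49 / 50), so this file re-states its definitions and lemmas under
PRIMED names (`unionL'`, `newCount'`, `eRk_add_newCount'_le_ncard`, `newCount'_le_nullity`; d1799 stays the citation) and proves the bridge
on them.  THE SPEC (`HypergraphBound d P`): every finite linear `3`-uniform hypergraph, on any point type, whose lists of members all have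
growth count `newCountF ≤ d` and which satisfies the flat-size clauses `(2, 3), (3, 6), (4, 10)` on every `S ⊆ points H` (`Clause`) has
`≤ P` members — the computed table `P(ν) = 1, 2, 4, 5, 7, 10, 11, 13` (proofs/P3-TRIANGLE-CAP.md §3–§4, §7b).  THE BRIDGE: on a finite
matroid with `|E| = r(E) + d` whose sets of rank `≤ 2 / 3 / 4` have `≤ 3 / 6 / 10` points, the hypergraph of `3`-circuits is admissible
at `d`, so `s₃ ≤ P` whenever `HypergraphBound d P` (**`ncard_triangles_le_of_hypergraphBound`**; `…_of_free` on the e-free core).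
Axioms: standard.
-/

namespace PercRepro
namespace TriangleCap
open Set
variable {α : Type}

/-! ### `TriangleNullity` re-stated under primed names (d1799 is the citation) -/

/-- The union of the members of a list of sets. -/
def unionL' : List (Set α) → Set α
  | [] => ∅
  | C :: L => C ∪ unionL' L

open Classical in
/-- The number of positions of `L` whose set has a point outside the union of the members after it in the list
(the members after it are the ones added before it in the growth order). -/
noncomputable def newCount' : List (Set α) → ℕ
  | [] => 0
  | C :: L => newCount' L + (if C ⊆ unionL' L then 0 else 1)

/-- `unionL'` of the empty list. -/
@[simp] theorem unionL'_nil : unionL' ([] : List (Set α)) = ∅ := rfl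

/-- `unionL'` of a cons. -/
@[simp] theorem unionL'_cons (C : Set α) (L : List (Set α)) : unionL' (C :: L) = C ∪ unionL' L := rfl

/-- `newCount'` of the empty list. -/
@[simp] theorem newCount'_nil : newCount' ([] : List (Set α)) = 0 := rfl

open Classical in
/-- `newCount'` of a cons: the tail's count plus one when the head has a point outside the tail's union. -/
theorem newCount'_cons (C : Set α) (L : List (Set α)) :
    newCount' (C :: L) = newCount' L + (if C ⊆ unionL' L then 0 else 1) := rfl

/-- The union of a list of subsets of the ground set lies in the ground set. -/
theorem unionL'_subset_ground (M : Matroid α) (L : List (Set α)) (hL : ∀ C ∈ L, C ⊆ M.E) :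
    unionL' L ⊆ M.E := by
  induction L with
  | nil => simp
  | cons C L ih =>
    rw [unionL'_cons]
    exact union_subset (hL C (List.mem_cons_self ..)) (ih fun D hD => hL D (List.mem_cons_of_mem _ hD))

/-- **The nullity lemma.** For a list `L` of `3`-circuits of a finite matroid,
`r(⋃ L) + newCount' L ≤ |⋃ L|`. -/
theorem eRk_add_newCount'_le_ncard (M : Matroid α) [M.Finite] (L : List (Set α))
    (hL : ∀ C ∈ L, M.IsCircuit C ∧ C.ncard = 3) :
    M.eRk (unionL' L) + newCount' L ≤ ((unionL' L).ncard : ℕ∞) := by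
  induction L with
  | nil => simp
  | cons C L ih =>
    have hC := hL C (List.mem_cons_self ..)
    have ih' := ih fun D hD => hL D (List.mem_cons_of_mem _ hD)
    have hUE : unionL' L ⊆ M.E :=
      unionL'_subset_ground M L fun D hD => (hL D (List.mem_cons_of_mem _ hD)).1.subset_ground
    have hUfin : (unionL' L).Finite := M.ground_finite.subset hUE
    have hCfin : C.Finite := M.ground_finite.subset hC.1.subset_ground
    rw [unionL'_cons, newCount'_cons]
    by_cases hsub : C ⊆ unionL' L
    · rw [if_pos hsub, union_eq_self_of_subset_left hsub]
      simpa using ih'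
    · rw [if_neg hsub]
      obtain ⟨x, hxC, hxU⟩ : ∃ x ∈ C, x ∉ unionL' L := not_subset.1 hsub
      -- the rank of `C ∪ U` is the rank of `(C \ {x}) ∪ U`, as `x ∈ cl (C \ {x})`
      have hcl : M.closure (C \ {x}) = M.closure C :=
        Matroid.closure_sdiff_singleton_eq_closure (hC.1.mem_closure_sdiff_singleton_of_mem hxC)
      have hrk : M.eRk (C ∪ unionL' L) = M.eRk ((C \ {x}) ∪ unionL' L) := by
        rw [← M.eRk_closure_eq, ← M.eRk_closure_eq ((C \ {x}) ∪ _),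
          Matroid.closure_union_congr_left hcl]
      -- `(C \ {x}) ∪ U = U ∪ ((C \ {x}) \ U)` and the rank of that is at most `r(U) + |(C \ {x}) \ U|`
      have hrk2 : M.eRk ((C \ {x}) ∪ unionL' L) ≤ M.eRk (unionL' L) + ((C \ {x}) \ unionL' L).encard := by
        rw [union_comm, ← union_sdiff_self]
        exact M.eRk_union_le_eRk_add_encard _ _
      -- the counts
      have hDfin : ((C \ {x}) \ unionL' L).Finite := hCfin.subset (fun y hy => hy.1.1)
      have hcnt : (C ∪ unionL' L).ncard = (unionL' L).ncard + (((C \ {x}) \ unionL' L).ncard + 1) := by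
        rw [union_comm, ← union_sdiff_self, ncard_union_eq disjoint_sdiff_right hUfin (hCfin.subset sdiff_subset)]
        congr 1
        have hx' : x ∈ C \ unionL' L := ⟨hxC, hxU⟩
        rw [← ncard_sdiff_singleton_add_one hx' (hCfin.subset sdiff_subset)]
        congr 2
        ext y
        simp only [mem_sdiff, mem_singleton_iff]
        tauto
      rw [hrk, hcnt]
      have hDcast : (((C \ {x}) \ unionL' L).ncard : ℕ∞) = ((C \ {x}) \ unionL' L).encard :=
        hDfin.cast_ncard_eq
      calc M.eRk ((C \ {x}) ∪ unionL' L) + (newCount' L + 1 : ℕ)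
          ≤ (M.eRk (unionL' L) + ((C \ {x}) \ unionL' L).encard) + (newCount' L + 1 : ℕ) := by
            gcongr
        _ = (M.eRk (unionL' L) + newCount' L) + (((C \ {x}) \ unionL' L).encard + 1) := by
            push_cast; ring
        _ ≤ ((unionL' L).ncard : ℕ∞) + (((C \ {x}) \ unionL' L).encard + 1) := by
            gcongr
        _ = (((unionL' L).ncard + (((C \ {x}) \ unionL' L).ncard + 1) : ℕ) : ℕ∞) := by
            rw [← hDcast]; push_cast; ring

/-- The growth count of any list of triangles of `M` is at most the nullity `d` of `M` (`|E| = r(E) + d`). -/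
theorem newCount'_le_nullity (M : Matroid α) [M.Finite] (L : List (Set α))
    (hL : ∀ C ∈ L, C ∈ ThmN.triangles M) {d : ℕ} (hd : M.E.encard = M.eRank + d) :
    newCount' L ≤ d := by
  have hL' : ∀ C ∈ L, M.IsCircuit C ∧ C.ncard = 3 := fun C hC => hL C hC
  have h := eRk_add_newCount'_le_ncard M L hL'
  have hUE : unionL' L ⊆ M.E := unionL'_subset_ground M L fun C hC => (hL' C hC).1.subset_ground
  -- `|U| − r(U) ≤ |E| − r(E) = d`: `r(E) ≤ r(U) + |E \ U|` (submodularity) and `|E| = |U| + |E \ U|`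
  have hUfin : (unionL' L).Finite := M.ground_finite.subset hUE
  have hDfin : (M.E \ unionL' L).Finite := M.ground_finite.subset sdiff_subset
  have h1 : M.eRank ≤ M.eRk (unionL' L) + (M.E \ unionL' L).encard := by
    calc M.eRank = M.eRk (unionL' L ∪ (M.E \ unionL' L)) := by rw [M.eRank_def, union_sdiff_cancel hUE]
      _ ≤ _ := M.eRk_union_le_eRk_add_encard _ _
  have hcard : M.E.encard = (unionL' L).encard + (M.E \ unionL' L).encard := by
    rw [← encard_union_eq disjoint_sdiff_right, union_sdiff_cancel hUE]
  -- everything is finite: pass to `ℕ`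
  have hrne : M.eRk (unionL' L) ≠ ⊤ :=
    ((M.eRk_le_encard _).trans_lt hUfin.encard_lt_top).ne
  obtain ⟨r, hr⟩ := ENat.ne_top_iff_exists.1 hrne
  have hRne : M.eRank ≠ ⊤ :=
    ((M.eRank_le_encard_ground).trans_lt M.ground_finite.encard_lt_top).ne
  obtain ⟨R, hR⟩ := ENat.ne_top_iff_exists.1 hRne
  rw [← hr] at h h1
  rw [← hR] at h1 hd
  rw [← hUfin.cast_ncard_eq, ← hDfin.cast_ncard_eq] at hcard
  rw [← hDfin.cast_ncard_eq] at h1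
  rw [hcard] at hd
  have h' : r + newCount' L ≤ (unionL' L).ncard := by exact_mod_cast h
  have h1' : R ≤ r + (M.E \ unionL' L).ncard := by exact_mod_cast h1
  have hd' : (unionL' L).ncard + (M.E \ unionL' L).ncard = R + d := by exact_mod_cast hd
  omega

/-! ### The specification of the search and the bridge -/

section Hypergraph

variable {β : Type} [DecidableEq β]

/-- The union of the members of a list of finsets. -/
def unionF : List (Finset β) → Finset β
  | [] => ∅
  | t :: L => t ∪ unionF L

/-- The growth count of a list of finsets: the number of positions whose member has a point outside the union
of the members after it in the list (the members after it are the ones added before it in the growth order). -/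
def newCountF : List (Finset β) → ℕ
  | [] => 0
  | t :: L => newCountF L + (if t ⊆ unionF L then 0 else 1)

/-- `unionF` of the empty list. -/
@[simp] theorem unionF_nil : unionF ([] : List (Finset β)) = ∅ := rfl

/-- `unionF` of a cons. -/
@[simp] theorem unionF_cons (t : Finset β) (L : List (Finset β)) : unionF (t :: L) = t ∪ unionF L := rfl

/-- `newCountF` of the empty list. -/
@[simp] theorem newCountF_nil : newCountF ([] : List (Finset β)) = 0 := rfl

/-- `newCountF` of a cons. -/
theorem newCountF_cons (t : Finset β) (L : List (Finset β)) :
    newCountF (t :: L) = newCountF L + (if t ⊆ unionF L then 0 else 1) := rfl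

/-- The union of a list of subsets of `S` lies in `S`. -/
theorem unionF_subset {S : Finset β} {L : List (Finset β)} (hL : ∀ t ∈ L, t ⊆ S) : unionF L ⊆ S := by
  induction L with
  | nil => simp
  | cons t L ih =>
    rw [unionF_cons]
    exact Finset.union_subset (hL t (List.mem_cons_self ..)) (ih fun u hu => hL u (List.mem_cons_of_mem _ hu))

/-- `unionF` agrees with `unionL'` on the coerced list. -/
theorem coe_unionF (L : List (Finset β)) :
    ((unionF L : Finset β) : Set β) = unionL' (L.map (fun t : Finset β => (t : Set β))) := by
  induction L with
  | nil => simp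
  | cons t L ih => simp [ih]

/-- `newCountF` agrees with `newCount'` on the coerced list. -/
theorem newCountF_eq_newCount (L : List (Finset β)) :
    newCountF L = newCount' (L.map (fun t : Finset β => (t : Set β))) := by
  induction L with
  | nil => simp
  | cons t L ih =>
    rw [List.map_cons, newCountF_cons, newCount'_cons, ih, ← coe_unionF]
    by_cases h : t ⊆ unionF L
    · simp [h]
    · simp [h]

/-- The point set of a hypergraph (the union of its members). -/
def points (H : Finset (Finset β)) : Finset β := H.biUnion id

/-- A member lies in the point set. -/
theorem subset_points {H : Finset (Finset β)} {t : Finset β} (ht : t ∈ H) : t ⊆ points H :=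
  fun _ hx => Finset.mem_biUnion.2 ⟨t, ht, hx⟩

/-- A linear `3`-uniform hypergraph: every member has `3` points, two distinct members share `≤ 1` point. -/
def IsLinear3 (H : Finset (Finset β)) : Prop :=
  (∀ t ∈ H, t.card = 3) ∧ ∀ t ∈ H, ∀ t' ∈ H, t ≠ t' → (t ∩ t').card ≤ 1

/-- The growth constraint (c): every list of members of `H` has growth count at most `d`. -/
def GrowthLE (H : Finset (Finset β)) (d : ℕ) : Prop :=
  ∀ L : List (Finset β), (∀ t ∈ L, t ∈ H) → newCountF L ≤ d

/-- The flat-size clause `(k, f)`: a point set `S ⊆ points H` in which some list `L` of members inside `S`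
witnesses `|S| ≤ k + newCountF L` has at most `f` points. -/
def Clause (H : Finset (Finset β)) (k f : ℕ) : Prop :=
  ∀ S : Finset β, S ⊆ points H → ∀ L : List (Finset β), (∀ t ∈ L, t ∈ H ∧ t ⊆ S) →
    S.card ≤ k + newCountF L → S.card ≤ f

end Hypergraph

/-- **The hypergraph bound** (the specification of the finite search): every linear `3`-uniform hypergraph, on any
point type, with growth count `≤ d` and the flat-size clauses `(2, 3)`, `(3, 6)`, `(4, 10)` has at most `P`
members. -/
def HypergraphBound (d P : ℕ) : Prop :=
  ∀ {β : Type} [DecidableEq β] (H : Finset (Finset β)), IsLinear3 H → GrowthLE H d →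
    Clause H 2 3 → Clause H 3 6 → Clause H 4 10 → H.card ≤ P

/-- The hypergraph bound is monotone: down in `d`, up in `P`. -/
theorem HypergraphBound.mono {d d' P P' : ℕ} (h : HypergraphBound d' P') (hd : d ≤ d') (hP : P' ≤ P) :
    HypergraphBound d P := by
  intro β _ H hlin hgr h2 h3 h4
  exact (h H hlin (fun L hL => (hgr L hL).trans hd) h2 h3 h4).trans hP

variable {α : Type}

/-- **The nullity lemma inside a subset.** For a list `L` of `3`-circuits of a finite matroid with
`⋃ L ⊆ S ⊆ E`, `r(S) + newCount' L ≤ |S|` (`r(S) ≤ r(⋃ L) + |S \ ⋃ L|` by submodularity). -/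
theorem eRk_add_newCount'_le_ncard_of_subset (M : Matroid α) [M.Finite] (L : List (Set α))
    (hL : ∀ C ∈ L, M.IsCircuit C ∧ C.ncard = 3) {S : Set α} (hS : S ⊆ M.E) (hLS : unionL' L ⊆ S) :
    M.eRk S + newCount' L ≤ (S.ncard : ℕ∞) := by
  have h := eRk_add_newCount'_le_ncard M L hL
  have hSfin : S.Finite := M.ground_finite.subset hS
  have hUfin : (unionL' L).Finite := hSfin.subset hLS
  have hDfin : (S \ unionL' L).Finite := hSfin.subset sdiff_subset
  have h1 : M.eRk S ≤ M.eRk (unionL' L) + (S \ unionL' L).encard := by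
    calc M.eRk S = M.eRk (unionL' L ∪ (S \ unionL' L)) := by rw [union_sdiff_cancel hLS]
      _ ≤ _ := M.eRk_union_le_eRk_add_encard _ _
  have hcard : S.encard = (unionL' L).encard + (S \ unionL' L).encard := by
    rw [← encard_union_eq disjoint_sdiff_right, union_sdiff_cancel hLS]
  have hrne : M.eRk (unionL' L) ≠ ⊤ := ((M.eRk_le_encard _).trans_lt hUfin.encard_lt_top).ne
  obtain ⟨r, hr⟩ := ENat.ne_top_iff_exists.1 hrne
  have hRne : M.eRk S ≠ ⊤ := ((M.eRk_le_encard _).trans_lt hSfin.encard_lt_top).ne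
  obtain ⟨R, hR⟩ := ENat.ne_top_iff_exists.1 hRne
  rw [← hr] at h h1
  rw [← hR] at h1 ⊢
  rw [← hUfin.cast_ncard_eq, ← hDfin.cast_ncard_eq, ← hSfin.cast_ncard_eq] at hcard
  rw [← hDfin.cast_ncard_eq] at h1
  have h' : r + newCount' L ≤ (unionL' L).ncard := by exact_mod_cast h
  have h1' : R ≤ r + (S \ unionL' L).ncard := by exact_mod_cast h1
  have hc' : S.ncard = (unionL' L).ncard + (S \ unionL' L).ncard := by exact_mod_cast hcard
  have hfin : R + newCount' L ≤ S.ncard := by omega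
  exact_mod_cast hfin

open Classical in
/-- The triangles of a finite matroid as a finset of finsets. -/
noncomputable def triangleFinset (M : Matroid α) [M.Finite] : Finset (Finset α) :=
  (M.ground_finite.toFinset.powerset).filter (fun t : Finset α => M.IsCircuit (t : Set α) ∧ t.card = 3)

/-- Membership in `triangleFinset`. -/
theorem mem_triangleFinset (M : Matroid α) [M.Finite] {t : Finset α} :
    t ∈ triangleFinset M ↔ M.IsCircuit (t : Set α) ∧ t.card = 3 := by
  classical
  simp only [triangleFinset, Finset.mem_filter, Finset.mem_powerset, Finite.subset_toFinset]
  constructor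
  · exact fun h => h.2
  · exact fun h => ⟨h.1.subset_ground, h⟩

/-- The triangles of `M` are the coercions of the members of `triangleFinset M`. -/
theorem triangles_eq_image (M : Matroid α) [M.Finite] :
    ThmN.triangles M = (fun t : Finset α => (t : Set α)) '' (triangleFinset M : Set (Finset α)) := by
  ext C
  constructor
  · intro hC
    obtain ⟨hC, hC3⟩ := hC
    have hfin : C.Finite := M.ground_finite.subset hC.subset_ground
    refine ⟨hfin.toFinset, ?_, hfin.coe_toFinset⟩
    rw [Finset.mem_coe, mem_triangleFinset, hfin.coe_toFinset]
    exact ⟨hC, by rw [← hC3, ncard_eq_toFinset_card C hfin]⟩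
  · rintro ⟨t, ht, rfl⟩
    rw [Finset.mem_coe, mem_triangleFinset] at ht
    exact ⟨ht.1, by rw [ncard_coe_finset]; exact ht.2⟩

/-- `s₃ = |triangleFinset M|`. -/
theorem ncard_triangles_eq_card_triangleFinset (M : Matroid α) [M.Finite] :
    (ThmN.triangles M).ncard = (triangleFinset M).card := by
  rw [triangles_eq_image, ncard_image_of_injective _ Finset.coe_injective, ncard_coe_finset]

section Admissible

variable [DecidableEq α]

/-- The triangle hypergraph is linear `3`-uniform when every set of rank `≤ 2` has `≤ 3` points. -/
theorem isLinear3_triangleFinset (M : Matroid α) [M.Finite]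
    (h2 : ∀ S ⊆ M.E, M.eRk S ≤ 2 → S.ncard ≤ 3) : IsLinear3 (triangleFinset M) := by
  refine ⟨fun t ht => ((mem_triangleFinset M).1 ht).2, fun t ht t' ht' hne => ?_⟩
  rw [mem_triangleFinset] at ht ht'
  by_contra hlt
  obtain ⟨x, hx⟩ : (t ∩ t').Nonempty := Finset.card_pos.1 (by omega)
  have hx' := Finset.mem_inter.1 hx
  have hC : (t : Set α) ∈ ThmN.trianglesThrough M x :=
    ⟨ht.1, by rw [ncard_coe_finset]; exact ht.2, hx'.1⟩
  have hC' : (t' : Set α) ∈ ThmN.trianglesThrough M x :=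
    ⟨ht'.1, by rw [ncard_coe_finset]; exact ht'.2, hx'.2⟩
  have hne' : (t : Set α) ≠ t' := fun h => hne (Finset.coe_injective h)
  have hint := ThmN.inter_eq_singleton_of_mem_trianglesThrough M
    (fun L hL hL2 => h2 L hL hL2.le) hC hC' hne'
  have hcoe : ((t ∩ t' : Finset α) : Set α) = {x} := by rw [Finset.coe_inter]; exact hint
  have hcard : (t ∩ t').card = 1 := by rw [← ncard_coe_finset, hcoe, ncard_singleton]
  omega

/-- The growth constraint (c) for the triangle hypergraph: `newCountF L ≤ d` when `|E| = r(E) + d`. -/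
theorem growthLE_triangleFinset (M : Matroid α) [M.Finite] {d : ℕ} (hd : M.E.encard = M.eRank + d) :
    GrowthLE (triangleFinset M) d := by
  intro L hL
  rw [newCountF_eq_newCount]
  refine newCount'_le_nullity M _ ?_ hd
  intro C hC
  rw [List.mem_map] at hC
  obtain ⟨t, ht, rfl⟩ := hC
  have h := (mem_triangleFinset M).1 (hL t ht)
  exact ⟨h.1, by rw [ncard_coe_finset]; exact h.2⟩

/-- The flat-size clause `(k, f)` for the triangle hypergraph, from «every set of rank `≤ k` has `≤ f` points»:
`r(S) + newCountF L ≤ |S| ≤ k + newCountF L` gives `r(S) ≤ k`. -/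
theorem clause_triangleFinset (M : Matroid α) [M.Finite] {k f : ℕ}
    (hk : ∀ S ⊆ M.E, M.eRk S ≤ k → S.ncard ≤ f) : Clause (triangleFinset M) k f := by
  intro S hS L hL hcard
  have hSE : (S : Set α) ⊆ M.E := by
    intro x hx
    obtain ⟨t, ht, hxt⟩ := Finset.mem_biUnion.1 (hS hx)
    exact ((mem_triangleFinset M).1 ht).1.subset_ground hxt
  have hL' : ∀ C ∈ L.map (fun t : Finset α => (t : Set α)), M.IsCircuit C ∧ C.ncard = 3 := by
    intro C hC
    rw [List.mem_map] at hC
    obtain ⟨t, ht, rfl⟩ := hC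
    have h := (mem_triangleFinset M).1 (hL t ht).1
    exact ⟨h.1, by rw [ncard_coe_finset]; exact h.2⟩
  have hLS : unionL' (L.map (fun t : Finset α => (t : Set α))) ⊆ (S : Set α) := by
    rw [← coe_unionF, Finset.coe_subset]
    exact unionF_subset fun t ht => (hL t ht).2
  have h := eRk_add_newCount'_le_ncard_of_subset M _ hL' hSE hLS
  rw [← newCountF_eq_newCount, ncard_coe_finset] at h
  have hrne : M.eRk (S : Set α) ≠ ⊤ :=
    ((M.eRk_le_encard _).trans_lt S.finite_toSet.encard_lt_top).ne
  obtain ⟨r, hr⟩ := ENat.ne_top_iff_exists.1 hrne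
  rw [← hr] at h
  have h' : r + newCountF L ≤ S.card := by exact_mod_cast h
  have hrk : M.eRk (S : Set α) ≤ k := by
    rw [← hr]
    exact_mod_cast (by omega : r ≤ k)
  have hf := hk S hSE hrk
  rwa [ncard_coe_finset] at hf

end Admissible

/-- **The bridge.** In a finite matroid with `|E| = r(E) + d` in which every set of rank `≤ 2 / ≤ 3 / ≤ 4` has
`≤ 3 / ≤ 6 / ≤ 10` points, the number of `3`-circuits is at most `P` whenever `HypergraphBound d P`. -/
theorem ncard_triangles_le_of_hypergraphBound (M : Matroid α) [M.Finite]
    (h2 : ∀ S ⊆ M.E, M.eRk S ≤ 2 → S.ncard ≤ 3)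
    (h3 : ∀ S ⊆ M.E, M.eRk S ≤ 3 → S.ncard ≤ 6)
    (h4 : ∀ S ⊆ M.E, M.eRk S ≤ 4 → S.ncard ≤ 10)
    {d P : ℕ} (hd : M.E.encard = M.eRank + d) (hP : HypergraphBound d P) :
    (ThmN.triangles M).ncard ≤ P := by
  classical
  rw [ncard_triangles_eq_card_triangleFinset]
  exact hP (triangleFinset M) (isLinear3_triangleFinset M h2) (growthLE_triangleFinset M hd)
    (clause_triangleFinset M h2) (clause_triangleFinset M h3) (clause_triangleFinset M h4)

/-- **The bridge on the e-free core.** With `hfree` (every point has an `e`-free partition) the flat-size facts are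
the cell's `ncard_le_three_of_eRk_le_two_of_free`, `ncard_le_six_of_eRk_le_three_of_free` and
`ncard_le_ten_of_eRk_le_four_of_free`: `s₃ ≤ P` whenever `|E| = r(E) + d` and `HypergraphBound d P`. -/
theorem ncard_triangles_le_of_hypergraphBound_of_free (M : Matroid α) [M.Finite]
    (hfree : ∀ e ∈ M.E, ∃ A ⊆ M.E \ {e}, e ∉ M.closure A ∧ e ∉ M.closure ((M.E \ {e}) \ A))
    {d P : ℕ} (hd : M.E.encard = M.eRank + d) (hP : HypergraphBound d P) :
    (ThmN.triangles M).ncard ≤ P :=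
  ncard_triangles_le_of_hypergraphBound M
    (fun _ hS hr => ThmN.ncard_le_three_of_eRk_le_two_of_free M hfree hS hr)
    (fun _ hS hr => ThmN.ncard_le_six_of_eRk_le_three_of_free M hfree hS hr)
    (fun _ hS hr => ThmN.ncard_le_ten_of_eRk_le_four_of_free M hfree hS hr) hd hP

end TriangleCap

end PercRepro
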